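import Literature.Computability.Cryptography.PeikertMachineH1S
import HarnessLib

/-!
# Peikert 2009, Prop. 3.2 (machine level): the LWE-oracle `BDD` solver as a named fact, and the
# discharge of pqc.S20 from it

Topic `Computability/Cryptography` (family `pqc`). The named fact
`Literature.Computability.Cryptography.peikert_gapSVPZeta_to_lwe_classical` (pqc.S20; C. Peikert,
*Public-key cryptosystems from the worst-case shortest vector problem*, STOC 2009, Thm. 3.1: a
classical reduction from `GapSVP_{ζ,γ}` to search-`LWE_{q,Ψ̄_α}` for `γ = Õ(n/α)`,
`q ≥ ζ·ω(√(log n / n))`) is assembled in its printed proof from two components: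

1. (Thm. 3.1, the paper's new idea) a probabilistic polynomial-time decider of `GapSVP_{ζ,γ}` from any
   solver of the `f`-admissible `BDD` instances — PROVED in this tree, against solvers of the
   SLACK-admissible inputs (`Literature.Computability.Cryptography.Peikert2009.Spec.h1_gapSVP_to_bdd_S`,
   `PeikertMachineH1S.lean`, with the machine files `PeikertMachine*.lean`);
2. (Prop. 3.2 = Regev's Lemma 3.4 run classically, with the `D_{Λ*,r}`-samples produced by the GPV
   sampler of Prop. 2.8 on the reversed dual basis, Lemma 2.3) a probabilistic polynomial-time oracle
   algorithm `R` which, for every oracle solving search-`LWE_{q,Ψ̄_α}` on the average, finds the closest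
   vector on every admissible `BDD` input with overwhelming probability — NOT yet in the tree at the
   machine level (its law-level analysis is proved: `PeikertBDDIdealised.lean`, `PeikertBDDSchedule.lean`,
   `PeikertBDDDirect.lean`).

`Literature.Computability.Cryptography.peikert_gapSVPZeta_to_lwe_classical_of_bddSolverS` (proved) is
exactly "component 2 ⇒ pqc.S20". This file records component 2 as the named fact
`Literature.Computability.Cryptography.peikert2009_prop_3_2_bddSolver q α m` (verbatim the hypothesis
`h₂ˢ` of that theorem, over the tree's definitions `OracleAlg`, `OracleAlg.IsPolyTime`,
`Oracle.SolvesSearchLWE`, `Peikert2009.SolvesBDDS`) and PROVES the assembly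
`Literature.Computability.Cryptography.peikert_gapSVPZeta_to_lwe_classical_holds_of`.

The child does not restate the parent: it is a `BDD → LWE` statement (no `GapSVP`, no approximation
factor `γ`, no `ζ`), the parent a `GapSVP_{ζ,γ} → LWE` statement.

## Faithfulness notes

* Prop. 3.2 (full version p. 11): "Let … `q ≥ 2`, `α ∈ (0,1)` … There is a PPT reduction `R` that,
  given an oracle solving `LWE_{q,Ψ̄_α}` … a basis `B` of `Λ`, `r ≥ √2 q · η_ε(Λ*)` and a point `x`
  with `dist(x, Λ) ≤ αq/(√2 r)`, and samples from `D_{Λ*,r}`, finds (the unique) `v ∈ Λ` closest to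
  `x` with overwhelming probability." In the proof of Thm. 3.1 the `D_{Λ*,r}` samples are produced by
  `R` itself with the GPV sampler (Prop. 2.8), which needs `r ≥ maxᵢ ‖d̃ᵢ‖ · ω(√(log n))` for the
  reversed dual basis, i.e. `f(n)√(log n) ≤ r‖b̃ᵢ‖` (Lemma 2.3) for a growth witness `f → ∞`; these
  are conditions (i)–(iv) of `Peikert2009.BDDAdmissible q α f`. The fact asks `R` to succeed only on
  the SLACK-admissible inputs `Peikert2009.BDDAdmissibleS` (distance bound with a factor `3/4` to
  spare) — weaker than Prop. 3.2, and all that component 1 ever queries.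
* "overwhelming probability" = `∀ c, ∀ᶠ n, ≥ 1 - n^{-c}` (`Peikert2009.SolvesBDDS`); "PPT" =
  `OracleAlg.IsPolyTime` with random coins `coins` and round budget `fuel` (`OracleAlg.randRun`);
  the LWE oracle is an average-case solver with success `≥ 2/3` (`Oracle.SolvesSearchLWE … (2/3)`),
  as in the parent.
* The side conditions `IsPolyTimeParams q α m`, `IsPolyBounded m`, `q ≥ 2` and `α ∈ (0,1)`
  eventually are those of the parent / of Prop. 3.2.

## References

* C. Peikert, *Public-key cryptosystems from the worst-case shortest vector problem*, STOC 2009,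
  Prop. 3.2, Prop. 2.8, Lemma 2.3, Thm. 3.1 (full version pp. 8–12). [Peikert2009] [STOC2009]
* O. Regev, *On lattices, learning with errors, random linear codes, and cryptography*, J. ACM 56
  (2009), Lemma 3.4. [RegevLWE2009]
-/

noncomputable section

namespace Literature.Computability.Cryptography

open Filter Topology _root_.Computability Literature.Algebra.EuclideanLattices
  Literature.Computability.Complexity Literature.Computability.Cryptography.LWE

variable (q : ℕ → ℕ) [∀ n, NeZero (q n)] (α : ℕ → ℝ) (m : ℕ → ℕ)

/-- NAMED FACT — **Peikert 2009, Prop. 3.2 at the machine level (with the GPV sampler of Prop. 2.8),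
against slack-admissible inputs.** For parameters `q, α, m` poly-time computable from `1ⁿ`
(`IsPolyTimeParams`), `m` polynomially bounded, `q ≥ 2` and `α ∈ (0,1)` eventually, and every growth
witness `f → ∞`: there is ONE probabilistic polynomial-time oracle algorithm `R` (coins `coins`, round
budget `fuel`) such that for EVERY oracle `O` solving search-`LWE_{q,Ψ̄_α}` from `m n` samples with
probability `≥ 2/3`, `R^O` finds a closest lattice vector on every slack-admissible `BDD` input
`((B, x), r)` (`Peikert2009.BDDAdmissibleS q α f`: `B` nonsingular, `r > 0`, `f(n)√(log n) ≤ r‖b̃ᵢ‖`,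
`√2·q·η_{2⁻ⁿ}(Λ*) ≤ r`, `dist(x, Λ) ≤ (3/4)·αq/(√2 r)`) with overwhelming probability
(`Peikert2009.SolvesBDDS`: for every `c`, eventually in `n`, probability `≥ 1 - n^{-c}`). "There is a
PPT reduction `R` that, given an oracle solving `LWE_{q,Ψ̄_α}`, a basis `B`, `r ≥ √2 q·η_ε(Λ*)`, a point
`x` with `dist(x, Λ) ≤ αq/(√2 r)`, and samples from `D_{Λ*,r}`, finds the unique closest `v ∈ Λ` with
overwhelming probability" (Prop. 3.2), the samples being generated by the GPV sampler (Prop. 2.8,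
Lemma 2.3) as in the proof of Thm. 3.1.
Users take `(h : peikert2009_prop_3_2_bddSolver q α m)`.
[cite: Peikert2009, Prop. 3.2 with Prop. 2.8 and Lemma 2.3 (full version pp. 8–12)] -/
def peikert2009_prop_3_2_bddSolver : Prop :=
  ∀ (_ : IsPolyTimeParams q α m) (_ : IsPolyBounded m) (_ : ∀ᶠ n : ℕ in atTop, 2 ≤ q n)
    (_ : ∀ᶠ n : ℕ in atTop, 0 < α n ∧ α n < 1) (f : ℕ → ℝ), Tendsto f atTop atTop →
    ∃ (R : OracleAlg (List Bool)) (coins fuel : Polynomial ℕ), R.IsPolyTime (encodingList Bool) ∧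
      ∀ O : Oracle, O.SolvesSearchLWE q (fun n => discretizedGaussian (q n) (α n)) m (2 / 3) →
        Peikert2009.SolvesBDDS q α f R coins fuel O

/-- **Assembly (PROVED): pqc.S20 from Prop. 3.2 (machine level).**
`Literature.Computability.Cryptography.peikert_gapSVPZeta_to_lwe_classical q α m` follows from
`peikert2009_prop_3_2_bddSolver q α m` by
`Literature.Computability.Cryptography.peikert_gapSVPZeta_to_lwe_classical_of_bddSolverS` (component 1,
the `GapSVP_{ζ,γ} → BDD` decider, being proved in `PeikertMachineH1S.lean`).
[cite: Peikert2009, Thm. 3.1 (proof: Prop. 3.2 with Regev's Lemma 3.4)] -/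
theorem peikert_gapSVPZeta_to_lwe_classical_holds_of (h : peikert2009_prop_3_2_bddSolver q α m) :
    peikert_gapSVPZeta_to_lwe_classical q α m :=
  peikert_gapSVPZeta_to_lwe_classical_of_bddSolverS q α m h

end Literature.Computability.Cryptography

end
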